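import Mathlib.Order.Preorder.Finite
import Mathlib.Algebra.Order.BigOperators.Group.Finset
import Literature.Computability.Complexity.RossmanMonotoneCliqueProb
import HarnessLib

/-!
# Minterms and the ⋆-closure of monotone Boolean functions (Rossman 2010, §2, §5.1)

Toolkit for the proof of Rossman's Theorem 1 (`RossmanMonotoneCliqueProofs.lean`), over the
Boolean vectors `ι → Bool` of `RossmanMonotoneCliqueProb.lean` (graphs, when `ι` is the set of
potential edges). Two parts.

**Minterms** (Rossman 2010, §2, "Monotone Graph Functions": "`H` is a minterm of `f` if
`f(H) = 1` and `f(H') = 0` for all `H' ⊂ H`") and the minterm calculus of Observation 7 (p. 6):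

* `exists_minterm_le` — every accepted vector lies above a minterm;
* `IsMinterm.of_or` — `M(f ∨ g) ⊆ M(f) ∪ M(g)`;
* `IsMinterm.of_and` — `M(f ∧ g) ⊆ {m₁ ∪ m₂ : m₁ ∈ M(f), m₂ ∈ M(g)}` (`f, g` monotone);
* `isMinterm_indicator_iff` — `M(Ind_H) = {H}`, and `IsMinterm.of_or_exists_indicator` for a
  disjunction with finitely many indicators (the shape of one ⋆-closure step, Lemma 10/12);
* `isMinterm_of_forall_update` — a monotone `f` has `x` as a minterm as soon as `f x = 1` and
  switching off any single on-coordinate of `x` gives `0` (used for `K_A ∈ M(C̄)`, §6).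

**The ⋆-closure** (§5.1, second part of the file, see its section docstring): `fails`,
`IsClosedFn` (Definition 8), the closure algorithm `clStep`/`clIter`/`starClosure` (Lemma 10) with
`isClosedFn_starClosure`, `le_starClosure`, `IsMinterm.of_starClosure` (Lemma 12) and `prob_ne_starClosure_le`
(Lemma 11).

## References

* B. Rossman, *The monotone complexity of k-clique on random graphs*, FOCS 2010 (full version
  2009) / SIAM J. Comput. 43 (2014): §2, Observation 7 (p. 6), Definition 8, Lemmas 10–12
  (pp. 6–7) [Rossman2010].
-/

namespace Literature.Computability.Complexity

open Finset

variable {ι : Type*}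

/-- `m` is a *minterm* of the Boolean function `f`: `f m = 1` and `f y = 0` for every `y < m`
(Rossman 2010, §2). [cite: Rossman2010, §2 (p. 3)] -/
def IsMinterm (f : (ι → Bool) → Bool) (m : ι → Bool) : Prop :=
  f m = true ∧ ∀ y, y < m → f y = false

namespace IsMinterm

variable {f g : (ι → Bool) → Bool} {m : ι → Bool}

/-- A minterm is accepted. [folklore] -/
theorem eq_true (h : IsMinterm f m) : f m = true := h.1

/-- Everything strictly below a minterm is rejected. [folklore] -/
theorem eq_false_of_lt (h : IsMinterm f m) {y : ι → Bool} (hy : y < m) : f y = false := h.2 y hy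

/-- An accepted vector below a minterm is the minterm. [folklore] -/
theorem eq_of_le (h : IsMinterm f m) {y : ι → Bool} (hy : y ≤ m) (hfy : f y = true) : y = m := by
  by_contra hne
  have := h.2 y (lt_of_le_of_ne hy hne)
  rw [hfy] at this
  exact Bool.noConfusion this

/-- **`M(f ∨ g) ⊆ M(f) ∪ M(g)`** (Rossman 2010, Observation 7). [cite: Rossman2010, Observation 7 (p. 6)] -/
theorem of_or (h : IsMinterm (fun x => f x || g x) m) : IsMinterm f m ∨ IsMinterm g m := by
  obtain ⟨h1, h2⟩ := h
  simp only [Bool.or_eq_true] at h1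
  have hf : ∀ y, y < m → f y = false := fun y hy => by
    have := h2 y hy; simp only [Bool.or_eq_false_iff] at this; exact this.1
  have hg : ∀ y, y < m → g y = false := fun y hy => by
    have := h2 y hy; simp only [Bool.or_eq_false_iff] at this; exact this.2
  rcases h1 with h1 | h1
  · exact Or.inl ⟨h1, hf⟩
  · exact Or.inr ⟨h1, hg⟩

end IsMinterm

/-- **Every accepted vector lies above a minterm** (finiteness of the lattice). [folklore] -/
theorem exists_minterm_le [Fintype ι] {f : (ι → Bool) → Bool} {x : ι → Bool} (hx : f x = true) :
    ∃ m, m ≤ x ∧ IsMinterm f m := by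
  classical
  set S : Finset (ι → Bool) := univ.filter fun y => y ≤ x ∧ f y = true with hS
  have hxS : x ∈ S := by simp [hS, hx]
  obtain ⟨b, hbx, hb⟩ := S.exists_le_minimal hxS
  have hbS : b ∈ S := hb.prop
  simp only [hS, mem_filter, mem_univ, true_and] at hbS
  refine ⟨b, hbx, hbS.2, fun y hy => ?_⟩
  by_contra hfy
  rw [Bool.not_eq_false] at hfy
  have hyS : y ∈ S := by
    simp only [hS, mem_filter, mem_univ, true_and]
    exact ⟨hy.le.trans hbx, hfy⟩
  exact (lt_irrefl _) (hy.trans_le (hb.le_of_le hyS hy.le))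

/-- For a monotone `f`: `f x = 1` iff some minterm lies below `x`. [folklore] -/
theorem eq_true_iff_exists_minterm_le [Fintype ι] {f : (ι → Bool) → Bool} (hf : Monotone f)
    (x : ι → Bool) : f x = true ↔ ∃ m, m ≤ x ∧ IsMinterm f m := by
  refine ⟨exists_minterm_le, ?_⟩
  rintro ⟨m, hmx, hm⟩
  have := hf hmx
  rw [hm.1] at this
  exact top_le_iff.1 this

/-- **`M(f ∧ g) ⊆ {m₁ ∪ m₂ : m₁ ∈ M(f), m₂ ∈ M(g)}`** for monotone `f, g`
(Rossman 2010, Observation 7). [cite: Rossman2010, Observation 7 (p. 6)] -/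
theorem IsMinterm.of_and [Fintype ι] {f g : (ι → Bool) → Bool} {m : ι → Bool} (hf : Monotone f)
    (hg : Monotone g) (h : IsMinterm (fun x => f x && g x) m) :
    ∃ m₁ m₂, IsMinterm f m₁ ∧ IsMinterm g m₂ ∧ m₁ ≤ m ∧ m₂ ≤ m ∧ m = m₁ ⊔ m₂ := by
  obtain ⟨h1, h2⟩ := h
  simp only [Bool.and_eq_true] at h1
  obtain ⟨m₁, hm₁, hM₁⟩ := exists_minterm_le h1.1
  obtain ⟨m₂, hm₂, hM₂⟩ := exists_minterm_le h1.2
  refine ⟨m₁, m₂, hM₁, hM₂, hm₁, hm₂, ?_⟩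
  have hle : m₁ ⊔ m₂ ≤ m := sup_le hm₁ hm₂
  by_contra hne
  have hlt : m₁ ⊔ m₂ < m := lt_of_le_of_ne hle (Ne.symm hne)
  have := h2 _ hlt
  simp only [Bool.and_eq_false_iff] at this
  have hf1 : f (m₁ ⊔ m₂) = true := by
    have := hf (le_sup_left : m₁ ≤ m₁ ⊔ m₂); rw [hM₁.1] at this; exact top_le_iff.1 this
  have hg1 : g (m₁ ⊔ m₂) = true := by
    have := hg (le_sup_right : m₂ ≤ m₁ ⊔ m₂); rw [hM₂.1] at this; exact top_le_iff.1 this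
  rcases this with h | h
  · rw [hf1] at h; exact Bool.noConfusion h
  · rw [hg1] at h; exact Bool.noConfusion h

/-- **`M(Ind_H) = {H}`**: the indicator of "lies above `h`" (written on supports,
`onSet h ⊆ onSet x ↔ h ≤ x`) has the single minterm `h` (Rossman 2010, §2, "`H`-indicator").
[cite: Rossman2010, §2 (p. 3)] -/
theorem isMinterm_indicator_iff [Fintype ι] [DecidableEq ι] (h m : ι → Bool) :
    IsMinterm (fun x => decide (onSet h ⊆ onSet x)) m ↔ m = h := by
  constructor
  · rintro ⟨h1, h2⟩
    rw [decide_eq_true_eq, ← le_iff_onSet_subset] at h1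
    by_contra hne
    have := h2 h (lt_of_le_of_ne h1 (Ne.symm hne))
    simp at this
  · rintro rfl
    refine ⟨by simp, fun y hy => ?_⟩
    rw [decide_eq_false_iff_not, ← le_iff_onSet_subset]
    exact fun hle => (lt_irrefl _) (hy.trans_le hle)

/-- Minterms of a finite disjunction of indicators `⋁_{h ∈ S} Ind_h` belong to `S`. [folklore] -/
theorem IsMinterm.of_exists_indicator [Fintype ι] [DecidableEq ι] {S : Finset (ι → Bool)}
    {m : ι → Bool} (hm : IsMinterm (fun x => decide (∃ h ∈ S, onSet h ⊆ onSet x)) m) : m ∈ S := by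
  obtain ⟨h1, h2⟩ := hm
  rw [decide_eq_true_eq] at h1
  obtain ⟨h, hS, hle⟩ := h1
  rw [← le_iff_onSet_subset] at hle
  rcases eq_or_lt_of_le hle with rfl | hlt
  · exact hS
  · have := h2 h hlt
    rw [decide_eq_false_iff_not] at this
    exact absurd ⟨h, hS, subset_rfl⟩ this

/-- Minterms of `f ∨ ⋁_{h ∈ S} Ind_h` are minterms of `f` or members of `S` (the minterms added
by one ⋆-closure step; Rossman 2010, Lemma 12). [cite: Rossman2010, Lemma 12 (p. 7)] -/
theorem IsMinterm.of_or_exists_indicator [Fintype ι] [DecidableEq ι] {f : (ι → Bool) → Bool}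
    {S : Finset (ι → Bool)} {m : ι → Bool}
    (hm : IsMinterm (fun x => f x || decide (∃ h ∈ S, onSet h ⊆ onSet x)) m) :
    IsMinterm f m ∨ m ∈ S := by
  rcases hm.of_or with h | h
  · exact Or.inl h
  · exact Or.inr h.of_exists_indicator

/-- **The minterm of a variable**: `M(x ↦ x i) = {single edge i}`. [folklore] -/
theorem isMinterm_apply_iff [Fintype ι] [DecidableEq ι] (i : ι) (m : ι → Bool) :
    IsMinterm (fun x => x i) m ↔ m = indVec {i} := by
  have key : ∀ x : ι → Bool, indVec {i} ≤ x ↔ x i = true := fun x => by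
    rw [indVec_le_iff, singleton_subset_iff, mem_onSet]
  constructor
  · rintro ⟨h1, h2⟩
    have hle : indVec {i} ≤ m := (key m).2 h1
    by_contra hne
    have := h2 _ (lt_of_le_of_ne hle (Ne.symm hne))
    have h3 : indVec {i} i = true := (key _).1 le_rfl
    exact Bool.noConfusion (h3.symm.trans this)
  · rintro rfl
    refine ⟨(key _).1 le_rfl, fun y hy => ?_⟩
    by_contra hc
    rw [Bool.not_eq_false, ← key] at hc
    exact (lt_irrefl _) (hy.trans_le hc)

/-- **Minterm test for monotone functions**: if `f x = 1` and switching off any single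
on-coordinate of `x` gives `0`, then `x` is a minterm of `f` (used with `x = K_A`: a clique is a
minterm iff every clique-minus-an-edge is rejected; Rossman 2010, §6). [folklore] -/
theorem isMinterm_of_forall_update [Fintype ι] [DecidableEq ι] {f : (ι → Bool) → Bool}
    (hf : Monotone f) {x : ι → Bool} (hx : f x = true)
    (h : ∀ i, x i = true → f (Function.update x i false) = false) : IsMinterm f x := by
  refine ⟨hx, fun y hy => ?_⟩
  obtain ⟨i, hxi, -, hle⟩ := exists_le_update_false_of_lt hy
  have := hf hle
  rw [h i hxi] at this
  exact le_bot_iff.1 this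

/-! ### Monotonicity of the basic connectives -/

/-- Projections are monotone. [folklore] -/
theorem monotone_apply_bool (i : ι) : Monotone fun x : ι → Bool => x i := fun _ _ h => h i

/-- Disjunctions of monotone functions are monotone. [folklore] -/
theorem monotone_bor {f g : (ι → Bool) → Bool} (hf : Monotone f) (hg : Monotone g) :
    Monotone fun x => f x || g x := fun x y h => by
  have h1 := hf h; have h2 := hg h
  rw [Bool.le_iff_imp] at h1 h2 ⊢
  simp only [Bool.or_eq_true]
  tauto

/-- Conjunctions of monotone functions are monotone. [folklore] -/
theorem monotone_band {f g : (ι → Bool) → Bool} (hf : Monotone f) (hg : Monotone g) :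
    Monotone fun x => f x && g x := fun x y h => by
  have h1 := hf h; have h2 := hg h
  rw [Bool.le_iff_imp] at h1 h2 ⊢
  simp only [Bool.and_eq_true]
  tauto

/-- A disjunction of indicators `⋁_{h ∈ S} Ind_h` is monotone. [folklore] -/
theorem monotone_exists_indicator [Fintype ι] [DecidableEq ι] {S : Finset (ι → Bool)} :
    Monotone fun x : ι → Bool => decide (∃ h ∈ S, onSet h ⊆ onSet x) := by
  intro x y hxy
  rw [Bool.le_iff_imp, decide_eq_true_eq, decide_eq_true_eq]
  rintro ⟨h, hS, hle⟩
  exact ⟨h, hS, hle.trans ((le_iff_onSet_subset x y).1 hxy)⟩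

/-- A monotone function true at `h` is true above `h`. [folklore] -/
theorem eq_true_of_monotone_le {f : (ι → Bool) → Bool} (hf : Monotone f) {h x : ι → Bool}
    (hle : h ≤ x) (hh : f h = true) : f x = true := by
  have := hf hle; rw [hh] at this; exact top_le_iff.1 this

/-- A monotone function false at `x` is false below `x`. [folklore] -/
theorem eq_false_of_monotone_le {f : (ι → Bool) → Bool} (hf : Monotone f) {y x : ι → Bool}
    (hle : y ≤ x) (hx : f x = false) : f y = false := by
  have := hf hle; rw [hx] at this; exact le_bot_iff.1 this

end Literature.Computability.Complexity

/-!
## The ⋆-closure of a monotone Boolean function (Rossman 2010, §5.1)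

Rossman's closure operator, for a fixed bias `p` (the subcritical edge probability `p⁻`), a
threshold `t` (`= e^{-n^δ}`) and a finite set `K` of "small" vectors (`= I ∪ J`):

* `fails p f h = Pr_{x ∼ μ_p}[f (x ∪ h) = 0]` (`= 1 - E[f(G⁻ ∪ H)]`);
* `IsClosedFn p t K f` — Definition 8 (p. 6): `f` is ⋆-closed if for every `h ∈ K`,
  `Pr[f(G⁻ ∪ h) = 0] ≤ t` forces `f h = 1`;
* `clStep`, `clIter`, `starClosure` — the starClosure ALGORITHM of Lemma 10 (p. 7), run in rounds: each
  round adds the indicators `Ind_h` of all `h ∈ K` with `fails ≤ t`; after `|K| + 1` rounds the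
  result `starClosure p t K f` is ⋆-closed (`isClosedFn_starClosure`, by pigeonhole on the pairwise
  disjoint sets of newly added `h`), lies above `f` (`le_starClosure`), is monotone;
* `IsMinterm.of_starClosure` — Lemma 12 (p. 7): `M(f⋆) ⊆ M(f) ∪ K`;
* `prob_ne_starClosure_le` — Lemma 11 (p. 7) at `H = ∅`: `Pr[f(G⁻) ≠ f⋆(G⁻)] ≤ |K| · t`;
* `IsClosedFn.band`, `isClosedFn_apply` — conjunctions of closed functions and the input
  variables are closed (§5.2, proof of Lemma 14).

We do not prove that `starClosure` is the LEAST closed function above `f` (not needed).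

## References

* B. Rossman, *The monotone complexity of k-clique on random graphs*, FOCS 2010 (full version
  2009), Definition 8, Lemmas 10–12, pp. 6–7 [Rossman2010].
-/

noncomputable section

namespace Literature.Computability.Complexity

open Finset

variable {ι : Type*} [Fintype ι] [DecidableEq ι]

/-! ### Failure probabilities and closedness -/

/-- `fails p f h = Pr_{x ∼ μ_p}[f (x ∪ h) = 0] = 1 - E[f(G ∪ H)]` (Rossman 2010, Def. 8).
[cite: Rossman2010, Definition 8 (p. 6)] -/
def fails (p : ℝ) (f : (ι → Bool) → Bool) (h : ι → Bool) : ℝ := prob p fun x => f (x ⊔ h) = false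

/-- `fails` is a probability: nonnegative. [folklore] -/
theorem fails_nonneg {p : ℝ} (hp0 : 0 ≤ p) (hp1 : p ≤ 1) (f : (ι → Bool) → Bool) (h : ι → Bool) :
    0 ≤ fails p f h := prob_nonneg hp0 hp1 _

/-- A larger function fails less often. [folklore] -/
theorem fails_antitone {p : ℝ} (hp0 : 0 ≤ p) (hp1 : p ≤ 1) {f g : (ι → Bool) → Bool} (hfg : f ≤ g)
    (h : ι → Bool) : fails p g h ≤ fails p f h := by
  refine prob_mono hp0 hp1 fun x hx => ?_
  have := hfg (x ⊔ h)
  rw [hx] at this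
  exact le_bot_iff.1 this

/-- **⋆-closed functions** (Rossman 2010, Definition 8): `f` is ⋆-closed (for bias `p`, threshold
`t`, small vectors `K`) if `Pr[f(G ∪ h) = 0] ≤ t` implies `f h = 1` for every `h ∈ K`.
[cite: Rossman2010, Definition 8 (p. 6)] -/
def IsClosedFn (p t : ℝ) (K : Finset (ι → Bool)) (f : (ι → Bool) → Bool) : Prop :=
  ∀ h ∈ K, fails p f h ≤ t → f h = true

/-- **Conjunctions of ⋆-closed functions are ⋆-closed** (Rossman 2010, §5.1, "Note that
conjunctions of ⋆-closed functions are ⋆-closed"). [cite: Rossman2010, §5.1 (p. 7)] -/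
theorem IsClosedFn.band {p t : ℝ} (hp0 : 0 ≤ p) (hp1 : p ≤ 1) {K : Finset (ι → Bool)}
    {f g : (ι → Bool) → Bool} (hf : IsClosedFn p t K f) (hg : IsClosedFn p t K g) :
    IsClosedFn p t K fun x => f x && g x := by
  intro h hK hle
  have h1 : fails p f h ≤ t :=
    (prob_mono hp0 hp1 (fun x (hx : f (x ⊔ h) = false) => by simp [hx])).trans hle
  have h2 : fails p g h ≤ t :=
    (prob_mono hp0 hp1 (fun x (hx : g (x ⊔ h) = false) => by simp [hx])).trans hle
  simp [hf h hK h1, hg h hK h2]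

/-- **Input variables are ⋆-closed** as soon as `t < 1 - p` (Rossman 2010, proof of Lemma 14,
base case). [cite: Rossman2010, Lemma 14 (p. 8)] -/
theorem isClosedFn_apply {p t : ℝ} (htp : t < 1 - p) (K : Finset (ι → Bool)) (i : ι) :
    IsClosedFn p t K fun x => x i := by
  intro h _ hle
  by_contra hi
  rw [Bool.not_eq_true] at hi
  have hi' : h i = false := hi
  have : fails p (fun x => x i) h = 1 - p := by
    rw [fails, ← prob_apply_eq_false p i]
    refine prob_congr fun x => ?_
    change (x i || h i) = false ↔ x i = false
    rw [hi', Bool.or_false]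
  rw [this] at hle
  exact (lt_irrefl _) (hle.trans_lt htp)

/-- The constant `true` is ⋆-closed. [folklore] -/
theorem isClosedFn_const_true (p t : ℝ) (K : Finset (ι → Bool)) : IsClosedFn p t K fun _ => true :=
  fun _ _ _ => rfl

/-! ### The closure algorithm -/

/-- The vectors added in one round of the closure algorithm: the `h ∈ K` with
`Pr[f(G ∪ h) = 0] ≤ t` (Rossman 2010, Lemma 10). [cite: Rossman2010, Lemma 10 (p. 7)] -/
def clAdd (p t : ℝ) (K : Finset (ι → Bool)) (f : (ι → Bool) → Bool) : Finset (ι → Bool) :=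
  K.filter fun h => fails p f h ≤ t

/-- One round of the closure algorithm: `f ∨ ⋁_{h ∈ clAdd} Ind_h` (Rossman 2010, Lemma 10).
[cite: Rossman2010, Lemma 10 (p. 7)] -/
def clStep (p t : ℝ) (K : Finset (ι → Bool)) (f : (ι → Bool) → Bool) : (ι → Bool) → Bool :=
  fun x => f x || decide (∃ h ∈ clAdd p t K f, onSet h ⊆ onSet x)

/-- `n` rounds of the closure algorithm (Rossman 2010, Lemma 10). [cite: Rossman2010, Lemma 10 (p. 7)] -/
def clIter (p t : ℝ) (K : Finset (ι → Bool)) (f : (ι → Bool) → Bool) : ℕ → (ι → Bool) → Bool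
  | 0 => f
  | n + 1 => clStep p t K (clIter p t K f n)

/-- **The ⋆-closure `f⋆`** of `f`: the closure algorithm run for `|K| + 1` rounds, after which it
has stabilised at a ⋆-closed function (Rossman 2010, Lemma 10: "terminates after `t ≤ |I ∪ J|`
iterations and outputs `f⋆`"). [cite: Rossman2010, Lemma 10 (p. 7)] -/
def starClosure (p t : ℝ) (K : Finset (ι → Bool)) (f : (ι → Bool) → Bool) : (ι → Bool) → Bool :=
  clIter p t K f (#K + 1)

section

variable (p t : ℝ) (K : Finset (ι → Bool))

/-- `clIter 0 = f`. [folklore] -/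
@[simp] theorem clIter_zero (f : (ι → Bool) → Bool) : clIter p t K f 0 = f := rfl

/-- `clIter (n+1) = clStep (clIter n)`. [folklore] -/
theorem clIter_succ (f : (ι → Bool) → Bool) (n : ℕ) :
    clIter p t K f (n + 1) = clStep p t K (clIter p t K f n) := rfl

/-- One round only adds: `f ≤ clStep f`. [folklore] -/
theorem le_clStep (f : (ι → Bool) → Bool) : f ≤ clStep p t K f := fun x => by
  rw [Bool.le_iff_imp]; intro hx; simp [clStep, hx]

/-- One round preserves monotonicity. [folklore] -/
theorem monotone_clStep {f : (ι → Bool) → Bool} (hf : Monotone f) : Monotone (clStep p t K f) :=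
  monotone_bor hf monotone_exists_indicator

/-- The rounds increase: `clIter m ≤ clIter n` for `m ≤ n`. [folklore] -/
theorem clIter_mono (f : (ι → Bool) → Bool) {m n : ℕ} (hmn : m ≤ n) :
    clIter p t K f m ≤ clIter p t K f n := by
  induction hmn with
  | refl => exact le_rfl
  | step _ ih => exact ih.trans (le_clStep p t K _)

/-- Every round is monotone if `f` is. [folklore] -/
theorem monotone_clIter {f : (ι → Bool) → Bool} (hf : Monotone f) (n : ℕ) :
    Monotone (clIter p t K f n) := by
  induction n with
  | zero => exact hf
  | succ n ih => exact monotone_clStep p t K ih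

/-- A ⋆-closed monotone function is a fixed point of the closure round. [folklore] -/
theorem clStep_eq_self_of_isClosedFn {f : (ι → Bool) → Bool} (hf : Monotone f)
    (hc : IsClosedFn p t K f) : clStep p t K f = f := by
  funext x
  rcases hx : f x with _ | _
  · simp only [clStep, hx, Bool.false_or, decide_eq_false_iff_not]
    rintro ⟨h, hh, hle⟩
    rw [clAdd, mem_filter] at hh
    have h1 : f h = true := hc h hh.1 hh.2
    have h2 := eq_true_of_monotone_le hf ((le_iff_onSet_subset h x).2 hle) h1
    rw [hx] at h2
    exact Bool.noConfusion h2
  · simp [clStep, hx]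

/-- Once a round is ⋆-closed, all later rounds coincide with it. [folklore] -/
theorem clIter_eq_of_isClosedFn {f : (ι → Bool) → Bool} (hf : Monotone f) {m : ℕ}
    (hc : IsClosedFn p t K (clIter p t K f m)) {n : ℕ} (hmn : m ≤ n) :
    clIter p t K f n = clIter p t K f m := by
  induction hmn with
  | refl => rfl
  | step _ ih =>
    rw [clIter_succ, ih]
    exact clStep_eq_self_of_isClosedFn p t K (monotone_clIter p t K hf m) hc

/-- The vectors NEWLY accepted in round `n`: `h ∈ K` with `fails ≤ t` not yet accepted.
[cite: Rossman2010, Lemma 10 (p. 7)] -/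
def clNew (f : (ι → Bool) → Bool) (n : ℕ) : Finset (ι → Bool) :=
  K.filter fun h => fails p (clIter p t K f n) h ≤ t ∧ clIter p t K f n h = false

/-- A round with no new vector is ⋆-closed. [folklore] -/
theorem isClosedFn_clIter_of_clNew_eq_empty {f : (ι → Bool) → Bool} {n : ℕ}
    (h : clNew p t K f n = ∅) : IsClosedFn p t K (clIter p t K f n) := by
  intro h' hK hle
  by_contra hc
  rw [Bool.not_eq_true] at hc
  have : h' ∈ clNew p t K f n := by rw [clNew, mem_filter]; exact ⟨hK, hle, hc⟩
  rw [h] at this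
  exact absurd this (notMem_empty _)

/-- A newly accepted vector is accepted from the next round on. [folklore] -/
theorem clIter_eq_true_of_mem_clNew {f : (ι → Bool) → Bool} {n : ℕ} {h : ι → Bool}
    (hh : h ∈ clNew p t K f n) {m : ℕ} (hm : n + 1 ≤ m) : clIter p t K f m h = true := by
  rw [clNew, mem_filter] at hh
  have h1 : clIter p t K f (n + 1) h = true := by
    rw [clIter_succ]
    simp only [clStep, Bool.or_eq_true, decide_eq_true_eq]
    exact Or.inr ⟨h, by rw [clAdd, mem_filter]; exact ⟨hh.1, hh.2.1⟩, subset_rfl⟩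
  have := clIter_mono p t K f hm h
  rw [h1] at this
  exact top_le_iff.1 this

/-- The sets of newly accepted vectors of different rounds are disjoint. [folklore] -/
theorem disjoint_clNew (f : (ι → Bool) → Bool) {m n : ℕ} (hmn : m ≠ n) :
    Disjoint (clNew p t K f m) (clNew p t K f n) := by
  wlog hlt : m < n generalizing m n
  · exact (this hmn.symm (lt_of_le_of_ne (not_lt.1 hlt) hmn.symm)).symm
  rw [Finset.disjoint_left]
  intro h hm hn
  have h1 := clIter_eq_true_of_mem_clNew p t K hm (Nat.succ_le_of_lt hlt)
  rw [clNew, mem_filter] at hn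
  rw [hn.2.2] at h1
  exact Bool.noConfusion h1

/-- **Pigeonhole**: the total number of newly accepted vectors over any number of rounds is at
most `|K|` (Rossman 2010, Lemma 10: "each graph in `I ∪ J` can occur as `Hᵢ` only once").
[cite: Rossman2010, Lemma 10 (p. 7)] -/
theorem sum_card_clNew_le (f : (ι → Bool) → Bool) (N : ℕ) :
    ∑ n ∈ range N, #(clNew p t K f n) ≤ #K := by
  rw [← card_biUnion (fun m _ n _ hmn => disjoint_clNew p t K f hmn)]
  exact card_le_card (biUnion_subset.2 fun n _ => filter_subset _ _)

/-- Within `|K| + 1` rounds some round adds nothing new. [folklore] -/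
theorem exists_clNew_eq_empty (f : (ι → Bool) → Bool) :
    ∃ n, n ≤ #K ∧ clNew p t K f n = ∅ := by
  by_contra hne
  push Not at hne
  have h1 : ∀ n ∈ range (#K + 1), 1 ≤ #(clNew p t K f n) := fun n hn =>
    card_pos.2 (hne n (Nat.lt_succ_iff.1 (mem_range.1 hn)))
  have h2 := sum_le_sum h1
  have h3 := sum_card_clNew_le p t K f (#K + 1)
  simp only [sum_const, card_range, smul_eq_mul, mul_one] at h2
  omega

/-- **The closure is ⋆-closed** (Rossman 2010, Lemma 10). [cite: Rossman2010, Lemma 10 (p. 7)] -/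
theorem isClosedFn_starClosure {f : (ι → Bool) → Bool} (hf : Monotone f) :
    IsClosedFn p t K (starClosure p t K f) := by
  obtain ⟨n, hn, hnew⟩ := exists_clNew_eq_empty p t K f
  have hc := isClosedFn_clIter_of_clNew_eq_empty p t K hnew
  rw [starClosure, clIter_eq_of_isClosedFn p t K hf hc (by omega)]
  exact hc

/-- `f ≤ f⋆` (Rossman 2010, §5.1). [cite: Rossman2010, §5.1 (p. 6)] -/
theorem le_starClosure (f : (ι → Bool) → Bool) : f ≤ starClosure p t K f :=
  clIter_mono p t K f (Nat.zero_le _)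

/-- `f⋆` is monotone. [folklore] -/
theorem monotone_starClosure {f : (ι → Bool) → Bool} (hf : Monotone f) : Monotone (starClosure p t K f) :=
  monotone_clIter p t K hf _

/-- **Lemma 12** (Rossman 2010, p. 7): `M(f⋆) ⊆ M(f) ∪ I ∪ J` — every minterm of the closure is a
minterm of `f` or one of the small vectors. [cite: Rossman2010, Lemma 12 (p. 7)] -/
theorem IsMinterm.of_starClosure {f : (ι → Bool) → Bool} {m : ι → Bool}
    (hm : IsMinterm (starClosure p t K f) m) : IsMinterm f m ∨ m ∈ K := by
  suffices ∀ n, IsMinterm (clIter p t K f n) m → IsMinterm f m ∨ m ∈ K from this _ hm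
  intro n
  induction n with
  | zero => exact fun h => Or.inl h
  | succ n ih =>
    intro h
    rw [clIter_succ] at h
    rcases h.of_or_exists_indicator with h | h
    · exact ih h
    · exact Or.inr (mem_of_mem_filter _ h)

/-! ### Lemma 11: the closure rarely exceeds `f` on `G⁻` -/

/-- One round: `Pr[fₙ(G) = 0, fₙ₊₁(G) = 1] ≤ |New_n| · t` — a flip needs a newly accepted `h ⊆ G`,
and then `fₙ(G ∪ h) = fₙ(G) = 0`, an event of probability `fails ≤ t` (Rossman 2010, proof of
Lemma 11). [cite: Rossman2010, Lemma 11 (p. 7)] -/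
theorem prob_clIter_flip_le {p t : ℝ} (hp0 : 0 ≤ p) (hp1 : p ≤ 1) (K : Finset (ι → Bool))
    {f : (ι → Bool) → Bool} (hf : Monotone f) (n : ℕ) :
    prob p (fun x => clIter p t K f n x = false ∧ clIter p t K f (n + 1) x = true)
      ≤ #(clNew p t K f n) * t := by
  set g := clIter p t K f n with hg
  have hgm : Monotone g := monotone_clIter p t K hf n
  calc prob p (fun x => g x = false ∧ clIter p t K f (n + 1) x = true)
      ≤ prob p (fun x => ∃ h ∈ clNew p t K f n, g x = false ∧ onSet h ⊆ onSet x) := by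
        refine prob_mono hp0 hp1 fun x ⟨hx0, hx1⟩ => ?_
        rw [clIter_succ] at hx1
        simp only [clStep, ← hg, hx0, Bool.false_or, decide_eq_true_eq] at hx1
        obtain ⟨h, hh, hle⟩ := hx1
        refine ⟨h, ?_, hx0, hle⟩
        rw [clAdd, mem_filter] at hh
        rw [clNew, mem_filter]
        exact ⟨hh.1, hh.2, eq_false_of_monotone_le hgm ((le_iff_onSet_subset h x).2 hle) hx0⟩
    _ ≤ ∑ h ∈ clNew p t K f n, prob p (fun x => g x = false ∧ onSet h ⊆ onSet x) :=
        prob_exists_le hp0 hp1 _ _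
    _ ≤ ∑ h ∈ clNew p t K f n, t := by
        refine sum_le_sum fun h hh => ?_
        rw [clNew, mem_filter] at hh
        refine le_trans (prob_mono hp0 hp1 fun x ⟨hx0, hle⟩ => ?_) hh.2.1
        have : x ⊔ h = x := sup_eq_left.2 ((le_iff_onSet_subset h x).2 hle)
        change g (x ⊔ h) = false
        rw [this, hx0]
    _ = #(clNew p t K f n) * t := by rw [sum_const, nsmul_eq_mul]

/-- Telescoping: a flip from `f = 0` to `f_N = 1` happens in some round. [folklore] -/
theorem prob_flip_le_sum {p t : ℝ} (hp0 : 0 ≤ p) (hp1 : p ≤ 1) (K : Finset (ι → Bool))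
    (f : (ι → Bool) → Bool) (N : ℕ) :
    prob p (fun x => f x = false ∧ clIter p t K f N x = true)
      ≤ ∑ n ∈ range N, prob p (fun x => clIter p t K f n x = false ∧ clIter p t K f (n + 1) x = true) := by
  induction N with
  | zero =>
    rw [sum_range_zero]
    refine le_of_eq ((prob_congr fun x => ?_).trans (prob_false p))
    simp only [clIter_zero, iff_false, not_and]
    intro h1 h2; rw [h1] at h2; exact Bool.noConfusion h2
  | succ N ih =>
    rw [sum_range_succ]
    calc prob p (fun x => f x = false ∧ clIter p t K f (N + 1) x = true)
        ≤ prob p (fun x => (f x = false ∧ clIter p t K f N x = true) ∨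
            (clIter p t K f N x = false ∧ clIter p t K f (N + 1) x = true)) := by
          refine prob_mono hp0 hp1 fun x ⟨h0, h1⟩ => ?_
          rcases hN : clIter p t K f N x with _ | _
          · exact Or.inr ⟨rfl, h1⟩
          · exact Or.inl ⟨h0, rfl⟩
      _ ≤ _ := (prob_or_le hp0 hp1 _ _).trans (by linarith)

/-- **Lemma 11** (Rossman 2010, p. 7, the case `H = ∅`): `Pr[f(G⁻) = 0 ∧ f⋆(G⁻) = 1] ≤ |K| · t`
for `t ≥ 0` — the closure exceeds `f` only with tiny probability. [cite: Rossman2010, Lemma 11 (p. 7)] -/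
theorem prob_lt_starClosure_le {p t : ℝ} (hp0 : 0 ≤ p) (hp1 : p ≤ 1) (ht : 0 ≤ t)
    (K : Finset (ι → Bool)) {f : (ι → Bool) → Bool} (hf : Monotone f) :
    prob p (fun x => f x = false ∧ starClosure p t K f x = true) ≤ #K * t := by
  refine (prob_flip_le_sum hp0 hp1 K f _).trans ?_
  refine (sum_le_sum fun n _ => prob_clIter_flip_le hp0 hp1 K hf n).trans ?_
  rw [← sum_mul]
  refine mul_le_mul_of_nonneg_right ?_ ht
  exact_mod_cast sum_card_clNew_le p t K f _

/-- **Lemma 11, symmetric form**: `Pr[f(G⁻) ≠ f⋆(G⁻)] ≤ |K| · t` (as `f ≤ f⋆`).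
[cite: Rossman2010, Lemma 11 (p. 7)] -/
theorem prob_ne_starClosure_le {p t : ℝ} (hp0 : 0 ≤ p) (hp1 : p ≤ 1) (ht : 0 ≤ t)
    (K : Finset (ι → Bool)) {f : (ι → Bool) → Bool} (hf : Monotone f) :
    prob p (fun x => f x ≠ starClosure p t K f x) ≤ #K * t := by
  refine le_trans (le_of_eq (prob_congr fun x => ?_)) (prob_lt_starClosure_le hp0 hp1 ht K hf)
  have := le_starClosure p t K f x
  rw [Bool.le_iff_imp] at this
  rcases hx : f x with _ | _ <;> rcases hc : starClosure p t K f x with _ | _ <;> simp_all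

end

end Literature.Computability.Complexity
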